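import Summits.Ventures.GridStability.Models.InverterDroopFirstOrderCCTLossy

/-!
# GridStability/Models/InverterDroopFirstOrderVICCT — the first-order droop GFM with the VIRTUAL IMPEDANCE current limitation: the post-fault motion on the maximal-VI curve (V-18), robust return for any VI release instant, and the exact clearing time `t_cVI = (δ_maxVI − δ₀)/(k_i p*)` (V-20)–(V-21), (V-27)

Cell `gridfusion` (LADDER-GRIDFUSION rung G3.a; seat gridfusion-model-3 (g10); models/MODEL-3-NOTES.md §1
(P23)/(P31); rider of ★ #106 «G3.a-DROOP1-CCT-EXACT-THM»).  Companion of `InverterDroopFirstOrderCCT.lean`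
(no limiter / CSA, p549017) and `InverterDroopFirstOrderCCTLossy.lean` (p550138, the lossy map (II-30) is a
shifted sine).  [cite: Qoria2020, §V.3.2, eqs. (V-18)–(V-21); §V.3.4 (V-26)–(V-27); Fig. V-13, Fig. V-16]:
with the virtual impedance at its maximum (`I_s = I_max`) the delivered power is
`p_mes = V_m′V_e/√(X_T²+R_T²)·sin(arctan(R_T/X_T) + δ_m) − V_e²R_T/(X_T²+R_T²)` (V-18),
`X_T = X_c + X_g + X_VImax`, `R_T = R_c + R_g + R_VImax` — which IS the tree's printed lossy quasi-static map
`InverterDroop.pLossy V_m′ V_e R_T X_T` (II-30) (`pLossy_eq_shifted_sin`: with `R_T = Z sin φ`, `X_T = Z cos φ`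
it is `(V_eV_m′/Z) sin(δ + φ) − V_e² sin φ/Z`), so the post-fault motion «on the new curve p_mes in (V-18)»
(phase 3 of Fig. V-13) is the cell's `dδFirstOrderLossy V_m′ V_e R_T X_T` model, and the print's stability
limit `δ_cc = δ_maxVI` (V-20)–(V-21) is the UNSTABLE rest angle of that curve: with the VI-curve σ-angle
`δ₁ ∈ (−π/2, π/2)`, `(V_eV_m′/Z) sin δ₁ = p* + V_e² sin φ/Z`, one has `δ_maxVI = π − δ₁ − φ`
(PROVENANCE P-INV-8: the held text of (V-20) prints `arccos` where the shifted sine gives `arcsin`; the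
`arcsin` reading reproduces the printed `t_cVI = 165 ms`, the `arccos` one would give 232 ms — see the
instance file `InverterDroopVIQoriaP08.lean`).
WHAT IS CERTIFIED (kernel, 0 kit; generic in the droop record `P` and the VI-curve data):
* `firstOrder_phase_window` — a FINITE phase `[0, t_d]` of any first-order droop motion (any record with
  `ω_set = ω_e`, `k_i, P_max > 0`, rest angle `δ₁ ∈ (−π/2, π/2)`) cleared inside the window
  `(−π − δ₁, π − δ₁)` keeps the angle between the clearing angle and the rest angle (two Nagumo barriers,
  `Literature.Analysis.ODE.forall_le_of_hasDerivWithinAt_of_eq_imp_deriv_neg`; no exponential estimate);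
  `vi_phase_window` — the same on the maximal-VI curve (shift by `φ`);
* `vi_return` — VI RETURN ROBUST TO THE RELEASE RULE (phases 3–4 of Fig. V-13): unlimited rest angle
  `δ₀ ∈ [0, π/2)` (`P_max sin δ₀ = p*`), VI-curve rest angle `δ₁ − φ ≥ δ₀` (`φ ≥ 0`), motion on the maximal-VI
  curve on `[0, t_d]` and on the unlimited curve from ANY release instant `t_d ≥ 0` on, cleared at
  `δ(0) ∈ (δ₀, δ_maxVI)`: the angle stays between `δ(0)` and `δ₁ − φ` while the VI is at its maximum and the
  motion tends to `δ₀` («the system remains stable if the fault is cleared before `δ_maxVI`»);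
* `vi_cct_exact` — with the bolted-fault drift `δ₀ + k_i p* t` (V-26): `t_f < t_cVI = (δ_maxVI − δ₀)/(k_i p*)`
  (the tree's `tcSat δ₀ δ_maxVI`, same formula as (V-27)/(V-28)) ⇒ return for every release instant;
  `t_cVI < t_f` (clearing angle below `2π + δ₁ − φ`) and the VI kept at its maximum ⇒ the angle stays above
  `δ_maxVI` and tends to `2π + δ₁ − φ` (`lossy_poleSlip`): no return.  Both sides are theorems of the model.
THREE COLUMNS.  CERTIFIED: statements about MODEL M_droop1+VI (first-order droop GFM, MV-6D filter-less; the
post-fault converter on the MAXIMAL-VI quasi-static curve (V-18) while the VI acts — the intermediate curves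
`0 < Z_VI < Z_VImax` of phase 3 are NOT modelled: the VI is either at its maximum or released, the release
instant being an INPUT; bolted fault `p_mes ≡ 0`; `V_m′` a parameter).  MODELLED: which instants have the VI
active is decided by the current magnitude in the real control (V-6), outside M_droop1+VI.  VALIDATED: the
instance file juxtaposes the printed 165 ms.  Nothing here says a converter is stable.
-/

noncomputable section

open Real Set Filter Topology
open Summit.Ventures.GridStability.Models.ScalarFlow

namespace Summit.Ventures.GridStability.Models.InverterDroop.ReducedParams

variable {P : ReducedParams}

/-! ## §1 A finite phase of a first-order droop motion stays between the clearing angle and the rest angle -/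

/-- Upper barrier.  `ω_set = ω_e`, `k_i, P_max > 0`, rest angle `δ₁ ∈ [−π/2, π/2]` (`P_max sin δ₁ = p*`):
a first-order motion on `[0, t_d]` that starts below a level `M ∈ (δ₁, π − δ₁)` stays below it (the field is
negative at `M`). [folklore] -/
theorem firstOrder_phase_le (hω : P.ωset = P.ωe) (hk : 0 < P.ki) (hPm : 0 < P.Pmax)
    {δ₁ : ℝ} (hδ₁ : δ₁ ∈ Icc (-(π / 2)) (π / 2)) (heq : P.Pmax * sin δ₁ = P.pref)
    {td : ℝ} {ψ : ℝ → ℝ} (hψ : P.IsFirstOrderSolutionOn ψ (Icc 0 td))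
    {M : ℝ} (hM : M ∈ Ioo δ₁ (π - δ₁)) (h0 : ψ 0 ≤ M) : ∀ t ∈ Icc 0 td, ψ t ≤ M := by
  have hneg : P.dδFirstOrder M < 0 := by
    rw [P.dδFirstOrder_eq hω, ← heq]
    have := sin_lt_sin_of_mem_window hδ₁ hM
    rw [show P.ki * (P.Pmax * sin δ₁ - P.Pmax * sin M) = P.ki * P.Pmax * (sin δ₁ - sin M) by ring]
    exact mul_neg_of_pos_of_neg (mul_pos hk hPm) (by linarith)
  have h := Literature.Analysis.ODE.forall_le_of_hasDerivWithinAt_of_eq_imp_deriv_neg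
    (ι := Unit) (h := fun _ => ψ) (h' := fun _ t => P.dδFirstOrder (ψ t)) (c := fun _ => M) (T := td)
    (fun _ => hψ) (fun t _ _ _ hk' => by
      have hψt : ψ t = M := hk'
      show P.dδFirstOrder (ψ t) < 0
      rw [hψt]; exact hneg) (fun _ => h0)
  exact fun t ht => h t ht ()

/-- Lower barrier.  Same record; a first-order motion on `[0, t_d]` that starts above a level
`m ∈ (−π − δ₁, δ₁)` stays above it (the field is positive at `m`). [folklore] -/
theorem firstOrder_phase_ge (hω : P.ωset = P.ωe) (hk : 0 < P.ki) (hPm : 0 < P.Pmax)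
    {δ₁ : ℝ} (hδ₁ : δ₁ ∈ Icc (-(π / 2)) (π / 2)) (heq : P.Pmax * sin δ₁ = P.pref)
    {td : ℝ} {ψ : ℝ → ℝ} (hψ : P.IsFirstOrderSolutionOn ψ (Icc 0 td))
    {m : ℝ} (hm : m ∈ Ioo (-π - δ₁) δ₁) (h0 : m ≤ ψ 0) : ∀ t ∈ Icc 0 td, m ≤ ψ t := by
  have hpos : 0 < P.dδFirstOrder m := by
    rw [P.dδFirstOrder_eq hω, ← heq]
    have h1 : sin (-δ₁) < sin (-m) :=
      sin_lt_sin_of_mem_window (δ₀ := -δ₁) ⟨by linarith [hδ₁.2], by linarith [hδ₁.1]⟩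
        ⟨by linarith [hm.2], by linarith [hm.1]⟩
    rw [sin_neg, sin_neg] at h1
    rw [show P.ki * (P.Pmax * sin δ₁ - P.Pmax * sin m) = P.ki * P.Pmax * (sin δ₁ - sin m) by ring]
    exact mul_pos (mul_pos hk hPm) (by linarith)
  have h := Literature.Analysis.ODE.forall_le_of_hasDerivWithinAt_of_eq_imp_deriv_neg
    (ι := Unit) (h := fun _ t => -ψ t) (h' := fun _ t => -P.dδFirstOrder (ψ t)) (c := fun _ => -m)
    (T := td) (fun _ t ht => (hψ t ht).neg) (fun t _ _ _ hk' => by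
      have hk'' : -ψ t = -m := hk'
      have hψt : ψ t = m := by linarith
      show -P.dδFirstOrder (ψ t) < 0
      rw [hψt]; linarith) (fun _ => by show -ψ 0 ≤ -m; linarith)
  intro t ht
  have := h t ht ()
  change -ψ t ≤ -m at this
  linarith

/-- **A finite phase stays between the clearing angle and the rest angle.**  `ω_set = ω_e`, `k_i, P_max > 0`,
rest angle `δ₁ ∈ (−π/2, π/2)` (`P_max sin δ₁ = p*`), motion on `[0, t_d]` cleared at
`ψ(0) ∈ (−π − δ₁, π − δ₁)`: if `δ₁ ≤ ψ(0)` then `δ₁ ≤ ψ(t) ≤ ψ(0)`, and if `ψ(0) ≤ δ₁` then `ψ(0) ≤ ψ(t) ≤ δ₁`,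
for every `t ∈ [0, t_d]` (barriers at every level strictly between, then density). [folklore] -/
theorem firstOrder_phase_window (hω : P.ωset = P.ωe) (hk : 0 < P.ki) (hPm : 0 < P.Pmax)
    {δ₁ : ℝ} (hδ₁ : δ₁ ∈ Ioo (-(π / 2)) (π / 2)) (heq : P.Pmax * sin δ₁ = P.pref)
    {td : ℝ} {ψ : ℝ → ℝ} (hψ : P.IsFirstOrderSolutionOn ψ (Icc 0 td))
    (hc : ψ 0 ∈ Ioo (-π - δ₁) (π - δ₁)) {t : ℝ} (ht : t ∈ Icc 0 td) :
    (δ₁ ≤ ψ 0 → δ₁ ≤ ψ t ∧ ψ t ≤ ψ 0) ∧ (ψ 0 ≤ δ₁ → ψ 0 ≤ ψ t ∧ ψ t ≤ δ₁) := by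
  have hδ₁' : δ₁ ∈ Icc (-(π / 2)) (π / 2) := ⟨hδ₁.1.le, hδ₁.2.le⟩
  have hle := fun {M : ℝ} (hM : M ∈ Ioo δ₁ (π - δ₁)) (h0 : ψ 0 ≤ M) =>
    firstOrder_phase_le hω hk hPm hδ₁' heq hψ hM h0 t ht
  have hge := fun {m : ℝ} (hm : m ∈ Ioo (-π - δ₁) δ₁) (h0 : m ≤ ψ 0) =>
    firstOrder_phase_ge hω hk hPm hδ₁' heq hψ hm h0 t ht
  -- the two density arguments
  have hlow : δ₁ ≤ ψ 0 → δ₁ ≤ ψ t := by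
    intro h0
    by_contra hlt
    push Not at hlt
    have hm : max ((ψ t + δ₁) / 2) (-(π / 2)) ∈ Ioo (-π - δ₁) δ₁ :=
      ⟨lt_of_lt_of_le (by linarith [hδ₁.1]) (le_max_right _ _), max_lt (by linarith) (by linarith [hδ₁.1])⟩
    have := hge hm ((max_lt (by linarith) (by linarith [hδ₁.1]) : _ < δ₁).le.trans h0)
    linarith [le_max_left ((ψ t + δ₁) / 2) (-(π / 2))]
  have hupp : ψ 0 ≤ δ₁ → ψ t ≤ δ₁ := by
    intro h0
    by_contra hlt
    push Not at hlt
    have hM : min ((ψ t + δ₁) / 2) (π / 2) ∈ Ioo δ₁ (π - δ₁) :=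
      ⟨lt_min (by linarith) hδ₁.2, lt_of_le_of_lt (min_le_right _ _) (by linarith [hδ₁.2])⟩
    have := hle hM (h0.trans (lt_min (by linarith) hδ₁.2 : δ₁ < _).le)
    linarith [min_le_left ((ψ t + δ₁) / 2) (π / 2)]
  refine ⟨fun h0 => ⟨hlow h0, ?_⟩, fun h0 => ⟨?_, hupp h0⟩⟩
  · -- ψ t ≤ ψ 0 when δ₁ ≤ ψ 0
    by_contra hlt
    push Not at hlt
    have hM : min ((ψ t + ψ 0) / 2) ((ψ 0 + (π - δ₁)) / 2) ∈ Ioo δ₁ (π - δ₁) :=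
      ⟨lt_min (by linarith) (by linarith [hc.2]), lt_of_le_of_lt (min_le_right _ _) (by linarith [hc.2])⟩
    have := hle hM (le_min (by linarith) (by linarith [hc.2]))
    linarith [min_le_left ((ψ t + ψ 0) / 2) ((ψ 0 + (π - δ₁)) / 2)]
  · -- ψ 0 ≤ ψ t when ψ 0 ≤ δ₁
    by_contra hlt
    push Not at hlt
    have hm : max ((ψ t + ψ 0) / 2) ((ψ 0 + (-π - δ₁)) / 2) ∈ Ioo (-π - δ₁) δ₁ :=
      ⟨lt_of_lt_of_le (by linarith [hc.1]) (le_max_right _ _), max_lt (by linarith) (by linarith [hc.1])⟩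
    have := hge hm (max_le (by linarith) (by linarith [hc.1]))
    linarith [le_max_left ((ψ t + ψ 0) / 2) ((ψ 0 + (-π - δ₁)) / 2)]

/-! ## §2 The maximal-VI curve: phase window, robust return, exact clearing time -/

/-- **Phase 3 of Fig. V-13 on the maximal-VI curve, finite phase `[0, t_d]`.**  VI-curve data `R_T = Z sin φ`,
`X_T = Z cos φ`, `V_eV_m′/Z > 0`, σ-angle `δ₁ ∈ (−π/2, π/2)` with `(V_eV_m′/Z) sin δ₁ = p* + V_e² sin φ/Z`
(rest angle of the VI curve `δ₁ − φ`, unstable one `δ_maxVI = π − δ₁ − φ`): a motion of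
`δ̇ = k_i(p* − pLossy V_m′ V_e R_T X_T δ)` on `[0, t_d]` cleared at `δ(0) ∈ (−π − δ₁ − φ, π − δ₁ − φ)` stays
between its clearing angle and `δ₁ − φ`. [cite: Qoria2020, §V.3.2, Fig. V-13 phase 3] -/
theorem vi_phase_window (hω : P.ωset = P.ωe) (hk : 0 < P.ki) {Vm Vg Rc Xc Z φ : ℝ} (hZ : Z ≠ 0)
    (hR : Rc = Z * sin φ) (hX : Xc = Z * cos φ) (hA : 0 < Vg * Vm / Z)
    {δ₁ : ℝ} (hδ₁ : δ₁ ∈ Ioo (-(π / 2)) (π / 2)) (heq : Vg * Vm / Z * sin δ₁ = P.pref + Vg ^ 2 * sin φ / Z)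
    {td : ℝ} {δ : ℝ → ℝ}
    (hδ : ∀ t ∈ Icc 0 td, HasDerivWithinAt δ (P.dδFirstOrderLossy Vm Vg Rc Xc (δ t)) (Icc 0 td) t)
    (hc : δ 0 ∈ Ioo (-π - δ₁ - φ) (π - δ₁ - φ)) {t : ℝ} (ht : t ∈ Icc 0 td) :
    (δ₁ - φ ≤ δ 0 → δ₁ - φ ≤ δ t ∧ δ t ≤ δ 0) ∧ (δ 0 ≤ δ₁ - φ → δ 0 ≤ δ t ∧ δ t ≤ δ₁ - φ) := by
  have h := firstOrder_phase_window (P := P.lossyShift Vm Vg Z φ) hω hk hA hδ₁ heq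
    (lossy_isFirstOrderSolutionOn_shift hZ hR hX hδ) (ψ := fun s => δ s + φ)
    ⟨by linarith [hc.1], by linarith [hc.2]⟩ ht
  obtain ⟨h1, h2⟩ := h
  refine ⟨fun h0 => ?_, fun h0 => ?_⟩
  · have := h1 (by linarith); constructor <;> linarith [this.1, this.2]
  · have := h2 (by linarith); constructor <;> linarith [this.1, this.2]

/-- **VI return, robust to the release rule (phases 3–4 of Fig. V-13).**  `ω_set = ω_e`, `k_i, P_max > 0`,
unlimited rest angle `δ₀ ∈ [0, π/2)` (`P_max sin δ₀ = p*`); VI-curve data as in `vi_phase_window` with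
`φ ≥ 0` and `δ₀ ≤ δ₁ − φ` (the VI curve lies below the unlimited one: its rest angle is larger).  Let the
post-fault motion `δ` run on the maximal-VI curve on `[0, t_d]` and on the unlimited curve from `t_d ≥ 0` on
(ANY release instant), cleared at `δ(0) ∈ (δ₀, δ_maxVI)`, `δ_maxVI = π − δ₁ − φ`.  Then during the VI phase the
angle stays between `δ(0)` and `δ₁ − φ`, and the motion tends to `δ₀` («the system remains stable if the fault
is cleared before `δ_maxVI`» [cite: Qoria2020, §V.3.2 (V-20)–(V-21); §V.3.5 Fig. V-16.a]). -/
theorem vi_return (hω : P.ωset = P.ωe) (hk : 0 < P.ki) (hPm : 0 < P.Pmax)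
    {δ₀ : ℝ} (hδ₀ : δ₀ ∈ Ico 0 (π / 2)) (heq0 : P.Pmax * sin δ₀ = P.pref)
    {Vm Vg Rc Xc Z φ : ℝ} (hZ : Z ≠ 0) (hR : Rc = Z * sin φ) (hX : Xc = Z * cos φ) (hA : 0 < Vg * Vm / Z)
    (hφ : 0 ≤ φ) {δ₁ : ℝ} (hδ₁ : δ₁ ∈ Ioo (-(π / 2)) (π / 2))
    (heq1 : Vg * Vm / Z * sin δ₁ = P.pref + Vg ^ 2 * sin φ / Z) (hord : δ₀ ≤ δ₁ - φ)
    {td : ℝ} (htd : 0 ≤ td) {δ : ℝ → ℝ}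
    (hvi : ∀ t ∈ Icc 0 td, HasDerivWithinAt δ (P.dδFirstOrderLossy Vm Vg Rc Xc (δ t)) (Icc 0 td) t)
    (hunl : P.IsFirstOrderSolutionOn (fun s => δ (td + s)) (Ici 0))
    (hc : δ 0 ∈ Ioo δ₀ (π - δ₁ - φ)) :
    (∀ t ∈ Icc 0 td, min (δ 0) (δ₁ - φ) ≤ δ t ∧ δ t ≤ max (δ 0) (δ₁ - φ)) ∧ Tendsto δ atTop (𝓝 δ₀) := by
  have hδ₀' : δ₀ ∈ Icc (-(π / 2)) (π / 2) := ⟨by linarith [hδ₀.1, pi_pos], hδ₀.2.le⟩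
  have hc' : δ 0 ∈ Ioo (-π - δ₁ - φ) (π - δ₁ - φ) := ⟨by linarith [hc.1, hδ₀.1, hδ₁.2, pi_pos], hc.2⟩
  have hwin : ∀ t ∈ Icc 0 td, min (δ 0) (δ₁ - φ) ≤ δ t ∧ δ t ≤ max (δ 0) (δ₁ - φ) := by
    intro t ht
    obtain ⟨h1, h2⟩ := vi_phase_window hω hk hZ hR hX hA hδ₁ heq1 hvi hc' ht
    rcases le_total (δ₁ - φ) (δ 0) with h0 | h0
    · have := h1 h0
      exact ⟨(min_le_right _ _).trans this.1, this.2.trans (le_max_left _ _)⟩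
    · have := h2 h0
      exact ⟨(min_le_left _ _).trans this.1, this.2.trans (le_max_right _ _)⟩
  refine ⟨hwin, ?_⟩
  obtain ⟨hland1, hland2⟩ := hwin td ⟨htd, le_rfl⟩
  -- phase 4 from the release angle `δ td ∈ [min, max] ⊂ [δ₀, π − δ₀)`
  have hwin_hi : δ td < π - δ₀ := by
    have : max (δ 0) (δ₁ - φ) < π - δ₀ := max_lt (by linarith [hc.2, hδ₁.2]) (by linarith [hδ₁.2, hδ₀.2])
    exact lt_of_le_of_lt hland2 this
  have hwin_lo : δ₀ ≤ δ td := (le_min hc.1.le hord).trans hland1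
  have key : Tendsto (fun s => δ (td + s)) atTop (𝓝 δ₀) := by
    rcases hwin_lo.eq_or_lt with heq' | hgt
    · have hz : P.dδFirstOrder δ₀ = 0 := by rw [P.dδFirstOrder_eq hω, ← heq0]; ring
      have hconst : ∀ s, 0 ≤ s → δ (td + s) = δ₀ := fun s hs =>
        firstOrder_eq_of_apply_eq_zero hω hPm.le hunl hz (by simpa using heq'.symm) hs
      refine tendsto_const_nhds.congr' ?_
      filter_upwards [eventually_ge_atTop (0:ℝ)] with s hs
      exact (hconst s hs).symm
    · exact (firstOrder_return hω hk hPm hδ₀' heq0 hunl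
        ⟨by simpa using hgt, by simpa using hwin_hi⟩).2.2
  have := key.comp (tendsto_atTop_add_const_left atTop (-td) tendsto_id)
  refine this.congr' ?_
  filter_upwards with t
  simp

/-- **EXACT CRITICAL CLEARING TIME with the virtual impedance** (both sides theorems of the model).
Operating point `p* > 0`, `P_max sin δ₀ = p*` (`δ₀ ∈ (0, π/2)`); VI-curve data as in `vi_return`; bolted fault
of duration `t_f > 0` from `δ₀` (fault-on motion `faultOn δ₀` (V-26)); `δ_maxVI = π − δ₁ − φ`,
`t_cVI = (δ_maxVI − δ₀)/(k_i p*)` (the tree's `tcSat δ₀ δ_maxVI`; (V-27)).  (i) `t_f < t_cVI`: for EVERY release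
instant `t_d ≥ 0`, every post-fault motion on the maximal-VI curve on `[0, t_d]` and unlimited afterwards
returns to `δ₀`; (ii) `t_cVI < t_f` (clearing angle below `2π + δ₁ − φ`): every motion that stays on the
maximal-VI curve keeps `δ > δ_maxVI` and tends to `2π + δ₁ − φ` — no return («the system loses the
synchronism when `t_fault > t_cVI`»). [cite: Qoria2020, §V.3.2 (V-20)–(V-21), §V.3.4 (V-26)–(V-27), §V.3.5 Fig. V-16] -/
theorem vi_cct_exact (hω : P.ωset = P.ωe) (hk : 0 < P.ki) (hPm : 0 < P.Pmax) (hp : 0 < P.pref)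
    {δ₀ : ℝ} (hδ₀ : δ₀ ∈ Ioo 0 (π / 2)) (heq0 : P.Pmax * sin δ₀ = P.pref)
    {Vm Vg Rc Xc Z φ : ℝ} (hZ : Z ≠ 0) (hR : Rc = Z * sin φ) (hX : Xc = Z * cos φ) (hA : 0 < Vg * Vm / Z)
    (hφ : 0 ≤ φ) {δ₁ : ℝ} (hδ₁ : δ₁ ∈ Ioo (-(π / 2)) (π / 2))
    (heq1 : Vg * Vm / Z * sin δ₁ = P.pref + Vg ^ 2 * sin φ / Z) (hord : δ₀ ≤ δ₁ - φ)
    {tf : ℝ} (htf : 0 < tf) :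
    (tf < P.tcSat δ₀ (π - δ₁ - φ) → ∀ td : ℝ, 0 ≤ td → ∀ δ : ℝ → ℝ,
        (∀ t ∈ Icc 0 td, HasDerivWithinAt δ (P.dδFirstOrderLossy Vm Vg Rc Xc (δ t)) (Icc 0 td) t) →
        P.IsFirstOrderSolutionOn (fun s => δ (td + s)) (Ici 0) →
        δ 0 = P.faultOn δ₀ tf → Tendsto δ atTop (𝓝 δ₀)) ∧
    (P.tcSat δ₀ (π - δ₁ - φ) < tf → P.faultOn δ₀ tf < 2 * π + δ₁ - φ → ∀ δ : ℝ → ℝ,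
        (∀ t ∈ Ici (0:ℝ), HasDerivWithinAt δ (P.dδFirstOrderLossy Vm Vg Rc Xc (δ t)) (Ici 0) t) →
        δ 0 = P.faultOn δ₀ tf →
        (∀ t, 0 ≤ t → π - δ₁ - φ < δ t) ∧ Tendsto δ atTop (𝓝 (2 * π + δ₁ - φ))) := by
  have hkp : 0 < P.ki * P.pref := mul_pos hk hp
  have hgt : δ₀ < P.faultOn δ₀ tf := by unfold faultOn; nlinarith
  have hδ₁' : δ₁ ∈ Icc (-(π / 2)) (π / 2) := ⟨hδ₁.1.le, hδ₁.2.le⟩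
  constructor
  · intro hlt td htd δ hvi hunl h0
    have hup : δ 0 < π - δ₁ - φ := by
      rw [h0]; exact (P.faultOn_lt_iff_tcSat hkp δ₀ (π - δ₁ - φ) tf).1.2 hlt
    exact (vi_return hω hk hPm ⟨hδ₀.1.le, hδ₀.2⟩ heq0 hZ hR hX hA hφ hδ₁ heq1 hord htd hvi hunl
      ⟨by rw [h0]; exact hgt, hup⟩).2
  · intro hlt h2π δ hvi h0
    have hlo : π - δ₁ - φ < δ 0 := by
      rw [h0]; exact (P.faultOn_lt_iff_tcSat hkp δ₀ (π - δ₁ - φ) tf).2.2 hlt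
    exact lossy_poleSlip hω hk hZ hR hX hA hδ₁' heq1 hvi ⟨hlo, by rw [h0]; linarith [h2π]⟩

/-- **The three clearing times are ORDERED by their clearing angles** (`t = (δ_cc − δ₀)/(k_i p*)` with the
common slope `k_i p* > 0`): `δ_maxSAT < δ_maxVI ⇒ t_cSAT < t_cVI` and `δ_maxVI < π − δ₀ ⇒ t_cVI < t_cc` — the
«Transient stability: CSA −, VI +» row of [cite: Qoria2020, Table V-2] and the two curves of Fig. V-15 are, on
the models, comparisons of clearing ANGLES. -/
theorem tcSat_lt_tcSat_iff (hkp : 0 < P.ki * P.pref) (δ₀ a b : ℝ) :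
    P.tcSat δ₀ a < P.tcSat δ₀ b ↔ a < b := by
  unfold tcSat
  rw [div_lt_div_iff_of_pos_right hkp]
  constructor <;> intro h <;> linarith

end Summit.Ventures.GridStability.Models.InverterDroop.ReducedParams

end
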